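import Summits.QuantumFields.YangMills.Theorems.BalabanLadderIRcofEquipartitionSeamKernelBridgesPeeling
import HarnessLib

/-!
# Line `equipartition_seam`, rev 8 (β) — BRIDGES, part 2: ★ B1 `equiUnits_of_window` and ★★ B2 `eblindUnitsV_of_peeling` (0 sorry)

Helper for crux `IRcof` (stmt-QuantumFields-26930), census row 47 «equipartition-seam».  The two bridge signatures KEYED by ym-ir-idea-22 g6 (bus
l.1607; `Cruxes/IRcof/Lines/equipartition_seam_KernelCurrency.lean` §D) for the rev-8 (β) re-pricing of S3 ∕ S4ᵛ, over the landed texts of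
`Theorems/BalabanLadderIRcofEquipartitionSeamKernelDefs.lean` (p687323 + p687588; R1 floor-free S3ʷ, `0 ≤ nrm A` in D's species clause, (N-b)
weight-anchored dressing — critic ym-ir-crit-3 g5 l.≈1616):

* ★ **B1 `equiUnits_of_window : EquiWindowV → LabelNoiseV → SplitVanishing → EquiUnits`** — S3 as a theorem of S3ʷ (at `s = 2S+1`) + N + S2ᵛ:
  thresholds `β_e = max(β_s, β_e', β_N)`, `S_e = max(S_e', S_N)`; at two electrically related sectors N compares `p_z, p_{z'}` with `Nrm·Z_w(·; 2S+1)`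
  at relative noise `e^{−(2S+1)}/8`, S3ʷ compares the two `Z_w` at rate `e^{−(2S+2)}`, and `abs_sub_le_of_noise_of_window` closes.
* ★★ **B2 `eblindUnitsV_of_peeling : EquiWindowV → VacuumSlackV → SpectralDictV → LabelNoiseV → EBlindUnitsV`** — S4ᵛ as a theorem:
  `β_b = max(β_s, β_w, β_T, β_D, β_N)`, species-UNIFORM `S_b(β) = max(S_w β, S_T β, S_D β, S_N β, 1)`, per species
  `C(A) = 41·|nrm A|·C_T + C_A + 2·C_A·e^{4·thick A}` (`C_A` from `A.bounded`); peeling regime `4·thick A ≤ 2S+1`: `canonical_eblind` +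
  `abs_secW_le` transported by N (`cross_transport`; the blind cover measure is a probability measure, `isProbabilityMeasure_wilsonMeasure`);
  small-`S` regime: the trivial bound `2·C_A·p_z·p_{z'} ≤ 2·C_A·e^{4 thick A}·e^{−(2S+1)}·p_z·p_{z'}` (`norm_setIntegral_le_of_norm_le_const`).
  The binders `β_e, S_e, hequi` of `EBlindUnitsV` (S3 on label classes) are not used: S3ʷ + N replace them.

Rev 8 then reads (idea-22's layout): `irnscCof_of_stubs := irnscCof_of_coverGapCofAll (coverGapCofAll_of stub_struct splitVanishing_holds
(equiUnits_of_window stub_equiWindowV stub_labelNoiseV splitVanishing_holds) (eblindUnitsV_of_peeling stub_equiWindowV stub_vacuumSlackV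
stub_spectralDictV stub_labelNoiseV) stub_pscUnitsCofV badRareUnits_holds mixUnits_holds)`.
HONEST: bookkeeping between OPEN located stubs (S1, S3ʷ, T, D, N, S5ᵛ untouched); width toward PXcof ∕ N_cof ∕ `IRcof` ∕ `IR` 0; the Yang–Mills
mass gap (Clay) is NOT proved anywhere in this tree; R4 closes only the conditional finite-𝕋⁴ rung `BalabanLadder.UV`.  Pool prover ym-ir-line-pool-p3 g16.
-/

set_option autoImplicit false

noncomputable section

open MeasureTheory Filter Topology
open Literature.MathematicalPhysics.QuantumFieldTheory Literature.MathematicalPhysics.QuantumLattice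
open Summit.QuantumFields.YangMills.Theorems.NonSimplyConnectedLatticeGap

namespace Summit.QuantumFields.YangMills.Cruxes.IRcof.EquipartitionSeam.KernelBridges

open KernelCurrency

/-! ## B1: S3 from S3ʷ + N + S2ᵛ -/

/-- **B1 `equiUnits_of_window`** — `EquiWindowV → LabelNoiseV → SplitVanishing → EquiUnits` (S3 as a THEOREM of rev 8 (β)).
At a cover datum: take the split rate `c` and weights `w_β` (S2ᵛ), the window thresholds `(β_e, S_e)` (S3ʷ) and the label-noise thresholds
`(β_N, S_N)` (N); for `β ≥ max β_s β_e β_N` and `S ≥ max (S_e β) (S_N β)`, two electrically related sectors `z, z'` lie in the electric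
family of `z'` (`z = withEl z' (elPart z)`), N compares `p_z, p_{z'}` with `Nrm·Z_w(·; 2S+1)` at relative noise `e^{−(2S+1)}/8`, S3ʷ at
`s = 2S+1` compares the two `Z_w` at rate `e^{−(2S+2)}`, and `abs_sub_le_of_noise_of_window` closes `|p_z − p_{z'}| ≤ e^{−(2S+1)} p_{z'}`. -/
theorem equiUnits_of_window (h3w : EquiWindowV) (hN : LabelNoiseV) (h2 : SplitVanishing) : EquiUnits := by
  intro G _ _ _ _ _ _ hG H _ _ _ _ _ _ hH hsc π hπ hsurj hker hfin hne ρH r _au _hau _hau0 _hfloor a cls hcls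
  obtain ⟨c, hc, β_s, hsplit⟩ := h2 G hG H hH hsc π hπ hsurj hker hfin hne ρH r
  obtain ⟨β_e, S_e, hEqui⟩ := h3w G hG H hH hsc π hπ hsurj hker hfin hne ρH r c hc
  obtain ⟨β_N, S_N, hNoise⟩ := hN G hG H hH hsc π hπ hsurj hker hfin hne ρH r a cls hcls c hc
  refine ⟨max β_s (max β_e β_N), fun β => max (S_e β) (S_N β), fun β hβ => ?_⟩
  have hβs : β_s ≤ β := le_trans (le_max_left _ _) hβ
  have hβe : β_e ≤ β := le_trans ((le_max_left _ _).trans (le_max_right _ _)) hβ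
  have hβN : β_N ≤ β := le_trans ((le_max_right _ _).trans (le_max_right _ _)) hβ
  obtain ⟨w, hw⟩ := hsplit β hβs
  have hw0 : ∀ h, 0 ≤ w h := hw.2.1
  have hEq := hEqui β hβe w hw
  have hNo := hNoise β hβN w hw
  intro S z z' hS hzz'
  have hSe : S_e β ≤ S := le_trans (le_max_left _ _) hS
  have hSN : S_N β ≤ S := le_trans (le_max_right _ _) hS
  obtain ⟨Nrm, hNrm, hp, -⟩ := hNo S hSN z'
  have hpz := hp (elPart π z)
  have hpz' := hp (elPart π z')
  rw [withEl_elPart_eq π hzz'] at hpz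
  rw [withEl_elPart_self π z'] at hpz'
  have hwin := hEq S hSe (2 * S + 1) (by omega) le_rfl (withEl π z' (elPart π z)) (withEl π z' (elPart π z'))
    (withEl_related π z' _ _)
  rw [withEl_elPart_eq π hzz', withEl_elPart_self π z'] at hwin
  have ht : (0 : ℝ) ≤ 2 * (S : ℝ) + 1 := by positivity
  have hexp : Real.exp (-(2 * (S : ℝ) + 2)) = Real.exp (-((2 * (S : ℝ) + 1) + 1)) := by ring_nf
  rw [hexp] at hwin
  exact abs_sub_le_of_noise_of_window (secZ_nonneg π hw0 _ _ _) (secZ_nonneg π hw0 _ _ _) hNrm ht hpz hpz' hwin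

/-! ## B2: S4ᵛ from S3ʷ + T + D + N -/

section Assembly

/-- `e^{−(t+1)} ≤ e^{−t}/2`. -/
theorem exp_neg_succ_le_half (t : ℝ) : Real.exp (-(t + 1)) ≤ Real.exp (-t) / 2 := by
  have h2 : (2 : ℝ) ≤ Real.exp 1 := by have := Real.add_one_le_exp (1 : ℝ); linarith
  have : Real.exp (-(t + 1)) = Real.exp (-t) * (Real.exp 1)⁻¹ := by
    rw [← Real.exp_neg, ← Real.exp_add]; ring_nf
  rw [this, div_eq_mul_inv]
  exact mul_le_mul_of_nonneg_left ((inv_le_inv₀ (by positivity) (by norm_num)).mpr h2) (Real.exp_pos _).le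

/-- **B2 `eblindUnitsV_of_peeling`** — `EquiWindowV → VacuumSlackV → SpectralDictV → LabelNoiseV → EBlindUnitsV` (S4ᵛ as a THEOREM of rev 8 (β)).
Per species `A`: constant `C(A) = 41·nrm A·C_T + C_A + 2·C_A·e^{4·thick A}` (`C_A` from `A.bounded`), thresholds `S_b(β) = max(S_e, S_T, S_D, S_N, 1)`
— species-UNIFORM.  For `4·thick A ≤ 2S+1`: the canonical peeling bound (`canonical_eblind`, via `ThickSpeciesDatum.eblind_thick_re`) and
the insertion bounds (`abs_secW_le`) are transported to label classes by N (`cross_transport`; `J` cancels identically); rate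
`2(40K e^{−(t+1)} + 4Kν + 4C_Aν) ≤ (41K + C_A)e^{−t}`.  For the finitely many `S` with `4·thick A > 2S+1`: the trivial bound `2C_A p_z p_{z'}`
(species bound) `≤ 2C_A e^{4 thick A} e^{−t} p_z p_{z'}`. -/
theorem eblindUnitsV_of_peeling (h3w : EquiWindowV) (hT : VacuumSlackV) (hD : SpectralDictV) (hN : LabelNoiseV) :
    EBlindUnitsV := by
  intro G _ _ _ _ _ _ hG H _ _ _ _ _ _ hH hsc π hπ hsurj hker hfin hne ρH r a cls hcls c hc β_s hsplit _β_e0 _S_e0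
    _hequi0
  obtain ⟨β_w, S_w, hWin⟩ := h3w G hG H hH hsc π hπ hsurj hker hfin hne ρH r c hc
  obtain ⟨C_T, β_T, S_T, hCT, hSlack⟩ := hT G hG H hH hsc π hπ hsurj hker hfin hne ρH r c hc
  obtain ⟨thick, nrm, β_D, S_D, hDict⟩ := hD G hG H hH hsc π hπ hsurj hker hfin hne ρH r c hc
  obtain ⟨β_N, S_N, hNoi⟩ := hN G hG H hH hsc π hπ hsurj hker hfin hne ρH r a cls hcls c hc
  refine ⟨max (max β_s β_w) (max β_T (max β_D β_N)),
    fun β => max (max (S_w β) (S_T β)) (max (S_D β) (max (S_N β) 1)), fun A => ?_⟩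
  obtain ⟨C_A, hC_A⟩ := A.bounded
  have hCA0 : 0 ≤ C_A := (abs_nonneg _).trans (hC_A (fun _ => 1))
  set K : ℝ := |nrm A| * C_T with hKdef
  have hK0 : 0 ≤ K := mul_nonneg (abs_nonneg _) hCT.le
  refine ⟨41 * K + C_A + 2 * C_A * Real.exp (4 * (thick A : ℝ)), fun β hβ => ?_⟩
  have hβs : β_s ≤ β := le_trans ((le_max_left _ _).trans (le_max_left _ _)) hβ
  have hβw : β_w ≤ β := le_trans ((le_max_right _ _).trans (le_max_left _ _)) hβ
  have hβT : β_T ≤ β := le_trans ((le_max_left _ _).trans (le_max_right _ _)) hβ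
  have hβD : β_D ≤ β := le_trans (((le_max_left _ _).trans (le_max_right _ _)).trans (le_max_right _ _)) hβ
  have hβN : β_N ≤ β := le_trans (((le_max_right _ _).trans (le_max_right _ _)).trans (le_max_right _ _)) hβ
  obtain ⟨w, hw⟩ := hsplit β hβs
  have hw0 : ∀ h, 0 ≤ w h := hw.2.1
  have hEq := hWin β hβw w hw
  have hSl := hSlack β hβT w hw
  have hDi := hDict β hβD w hw
  have hNo := hNoi β hβN w hw
  intro S z z' hS hrel
  have hSw : S_w β ≤ S := le_trans ((le_max_left _ _).trans (le_max_left _ _)) hS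
  have hST : S_T β ≤ S := le_trans ((le_max_right _ _).trans (le_max_left _ _)) hS
  have hSD : S_D β ≤ S := le_trans ((le_max_left _ _).trans (le_max_right _ _)) hS
  have hSN : S_N β ≤ S := le_trans (((le_max_left _ _).trans (le_max_right _ _)).trans (le_max_right _ _)) hS
  have hS1 : 1 ≤ S := le_trans (((le_max_right _ _).trans (le_max_right _ _)).trans (le_max_right _ _)) hS
  -- the blind cover measure on this torus is a probability measure
  haveI := isProbabilityMeasure_wilsonMeasure (d := 4) (L := 2 * S + 1) (r.ρ.comp π) (r.continuous.comp hπ) β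
  set μ : Measure (GaugeConfig 4 (2 * S + 1) H) := wilsonMeasure (r.ρ.comp π) β with hμ
  -- N at `(S, z')`: normalisation, weights, dressing
  obtain ⟨Nrm, hNrm, hpN, hIN⟩ := hNo S hSN z'
  obtain ⟨J, hJ⟩ := hIN A C_A hC_A
  have hz : withEl π z' (elPart π z) = z := withEl_elPart_eq π hrel
  have hz' : withEl π z' (elPart π z') = z' := withEl_elPart_self π z'
  have hpz := hpN (elPart π z)
  have hpz' := hpN (elPart π z')
  have hIz := hJ (elPart π z)
  have hIz' := hJ (elPart π z')
  rw [hz] at hpz hIz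
  rw [hz'] at hpz' hIz'
  set t : ℝ := 2 * (S : ℝ) + 1 with htdef
  set ν : ℝ := Real.exp (-t) / 8 with hνdef
  have hν0 : 0 ≤ ν := by positivity
  have hν8 : ν ≤ 1 / 8 := by
    have hexp1 : Real.exp (-t) ≤ 1 :=
      Real.exp_le_one_iff.mpr (by rw [htdef]; have : (0:ℝ) ≤ S := Nat.cast_nonneg S; linarith)
    rw [hνdef]
    linarith
  set pz : ℝ := (μ ((cls S) ⁻¹' {some z})).toReal with hpzdef
  set pz' : ℝ := (μ ((cls S) ⁻¹' {some z'})).toReal with hpz'def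
  have hpz0 : 0 ≤ pz := ENNReal.toReal_nonneg
  have hpz'0 : 0 ≤ pz' := ENNReal.toReal_nonneg
  have hZz : 0 ≤ secZ π w z S (2 * S + 1) := secZ_nonneg π hw0 _ _ _
  have hZz' : 0 ≤ secZ π w z' S (2 * S + 1) := secZ_nonneg π hw0 _ _ _
  have hexp_t : Real.exp (-(2 * (S : ℝ) + 1)) = Real.exp (-t) := by rw [htdef]
  by_cases hreg : 4 * thick A ≤ 2 * S + 1
  · -- PEELING regime
    have hnrmA : 0 ≤ nrm A := nrm_nonneg_of_spectralDictOn π hDi A S hSD hreg z'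
    have hKeq : nrm A * C_T = K := by rw [hKdef, abs_of_nonneg hnrmA]
    have hcross := canonical_eblind π hker hfin hw0 hEq hSl hCT.le hDi A S hS1 hSw hST hSD hreg z'
      (elPart π z) (elPart π z')
    have hWz := abs_secW_le π hw0 hEq hSl hCT.le hDi A hker S hS1 hSw hST hSD hreg z' (elPart π z)
    have hWz' := abs_secW_le π hw0 hEq hSl hCT.le hDi A hker S hS1 hSw hST hSD hreg z' (elPart π z')
    rw [hz, hz', hKeq] at hcross
    rw [hz, hKeq] at hWz
    rw [hz', hKeq] at hWz'
    have hM0 : 0 ≤ 40 * K * Real.exp (-(2 * (S : ℝ) + 2)) := by positivity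
    have htr := cross_transport hZz hZz' hNrm.le hν0 hν8 hCA0 hK0 hM0 hpz hpz' hIz hIz' hcross hWz hWz'
    refine htr.trans ?_
    have hδ : Real.exp (-(2 * (S : ℝ) + 2)) ≤ Real.exp (-t) / 2 := by
      have := exp_neg_succ_le_half t
      rw [htdef] at this ⊢
      have h' : -(2 * (S : ℝ) + 1 + 1) = -(2 * (S : ℝ) + 2) := by ring
      rw [h'] at this
      exact this
    have hpp : 0 ≤ pz * pz' := mul_nonneg hpz0 hpz'0
    have hrate : 2 * (40 * K * Real.exp (-(2 * (S : ℝ) + 2)) + 4 * K * ν + 4 * C_A * ν) ≤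
        (41 * K + C_A + 2 * C_A * Real.exp (4 * (thick A : ℝ))) * Real.exp (-(2 * (S : ℝ) + 1)) := by
      rw [hexp_t, hνdef]
      have h1 : 0 ≤ 2 * C_A * Real.exp (4 * (thick A : ℝ)) * Real.exp (-t) := by positivity
      have h2 : 40 * K * Real.exp (-(2 * (S : ℝ) + 2)) ≤ 40 * K * (Real.exp (-t) / 2) :=
        mul_le_mul_of_nonneg_left hδ (by positivity)
      nlinarith [h1, h2, Real.exp_pos (-t), hK0, hCA0]
    calc 2 * (40 * K * Real.exp (-(2 * (S : ℝ) + 2)) + 4 * K * ν + 4 * C_A * ν) * (pz * pz')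
        ≤ (41 * K + C_A + 2 * C_A * Real.exp (4 * (thick A : ℝ))) * Real.exp (-(2 * (S : ℝ) + 1)) * (pz * pz') :=
          mul_le_mul_of_nonneg_right hrate hpp
      _ = (41 * K + C_A + 2 * C_A * Real.exp (4 * (thick A : ℝ))) * Real.exp (-(2 * (S : ℝ) + 1)) * pz * pz' := by
          ring
  · -- SMALL-S regime: trivial bound from the species bound
    have hreg' : 2 * S + 1 < 4 * thick A := not_le.mp hreg
    have hIle : ∀ (zz : Sector π), |∫ V in ((cls S) ⁻¹' {some zz}), A.F (fun e => π (torusLift (2 * S + 1) V e)) ∂μ| ≤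
        C_A * (μ ((cls S) ⁻¹' {some zz})).toReal := by
      intro zz
      have h := norm_setIntegral_le_of_norm_le_const (μ := μ) (s := (cls S) ⁻¹' {some zz})
        (f := fun V => A.F (fun e => π (torusLift (2 * S + 1) V e))) (C := C_A) (measure_lt_top μ _)
        (fun V _ => by rw [Real.norm_eq_abs]; exact hC_A _)
      rw [Real.norm_eq_abs, measureReal_def] at h
      exact h
    have hIz1 := hIle z
    have hIz'1 := hIle z'
    have hbound : |pz' * (∫ V in ((cls S) ⁻¹' {some z}), A.F (fun e => π (torusLift (2 * S + 1) V e)) ∂μ) -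
        pz * (∫ V in ((cls S) ⁻¹' {some z'}), A.F (fun e => π (torusLift (2 * S + 1) V e)) ∂μ)| ≤ 2 * C_A * (pz * pz') := by
      refine (abs_sub _ _).trans ?_
      rw [abs_mul, abs_mul, abs_of_nonneg hpz0, abs_of_nonneg hpz'0]
      calc pz' * |∫ V in ((cls S) ⁻¹' {some z}), A.F (fun e => π (torusLift (2 * S + 1) V e)) ∂μ| +
            pz * |∫ V in ((cls S) ⁻¹' {some z'}), A.F (fun e => π (torusLift (2 * S + 1) V e)) ∂μ|
          ≤ pz' * (C_A * pz) + pz * (C_A * pz') :=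
            add_le_add (mul_le_mul_of_nonneg_left hIz1 hpz'0) (mul_le_mul_of_nonneg_left hIz'1 hpz0)
        _ = 2 * C_A * (pz * pz') := by ring
    refine hbound.trans ?_
    have hpp : 0 ≤ pz * pz' := mul_nonneg hpz0 hpz'0
    have hrate : 2 * C_A ≤ (41 * K + C_A + 2 * C_A * Real.exp (4 * (thick A : ℝ))) * Real.exp (-(2 * (S : ℝ) + 1)) := by
      have hge : 1 ≤ Real.exp (4 * (thick A : ℝ)) * Real.exp (-(2 * (S : ℝ) + 1)) := by
        rw [← Real.exp_add]
        apply Real.one_le_exp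
        have h' : ((2 * S + 2 : ℕ) : ℝ) ≤ ((4 * thick A : ℕ) : ℝ) := by exact_mod_cast (by omega)
        push_cast at h'
        linarith
      have h1 : 0 ≤ (41 * K + C_A) * Real.exp (-(2 * (S : ℝ) + 1)) := by positivity
      nlinarith [hge, h1, hCA0]
    calc 2 * C_A * (pz * pz')
        ≤ (41 * K + C_A + 2 * C_A * Real.exp (4 * (thick A : ℝ))) * Real.exp (-(2 * (S : ℝ) + 1)) * (pz * pz') :=
          mul_le_mul_of_nonneg_right hrate hpp
      _ = (41 * K + C_A + 2 * C_A * Real.exp (4 * (thick A : ℝ))) * Real.exp (-(2 * (S : ℝ) + 1)) * pz * pz' := by ring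

end Assembly

end Summit.QuantumFields.YangMills.Cruxes.IRcof.EquipartitionSeam.KernelBridges

end
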